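import Summits.SmoothPoincare4.SmoothPoincare4.Theses.RootDecompAC

/-! # RootDecompAC — the split glue `DiagonalDescentMinimalGlue` (item stmt-SmoothPoincare4-31760) PROVED.

`DiagonalDescentMinimalGlue : NonMinimalAscent → MinimalDiagonalLocality → MinimalPairCancellation → DiagonalDescent`
(route AC rev 1, `--split DiagonalDescent --into NonMinimalAscent MinimalDiagonalLocality MinimalPairCancellation`).
The glue is a case split on «the framed link `L` is MINIMAL» (no proper sub-link with ≥ 1 component is the link of an
ℝ-link sphere): non-minimal ⇒ `NonMinimalAscent`; minimal ⇒ `MinimalDiagonalLocality` either gives the standard sphere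
outright or produces a minimal complementary link `C` and a connected-sum splitting `M # N = S⁴`, which
`MinimalPairCancellation` cancels.  Text = lens-4 GEN 8 `split/SigCheck.lean` (`diagonalDescentMinimalGlue_holds_sigcheck`,
axioms {propext, Classical.choice, Quot.sound} recorded there), re-based on the born route file. -/

set_option linter.dupNamespace false

namespace Summit.SmoothPoincare4.SmoothPoincare4.Theorems.RootDecompACDiagonalDescentMinimalSplit

open scoped Manifold ContDiff
open Summit.SmoothPoincare4.SmoothPoincare4.Theses.RootDecompAC

/-- The split glue of route AC at `DiagonalDescent` holds outright (minimal / non-minimal dichotomy of the link). -/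
theorem diagonalDescentMinimalGlue_holds : DiagonalDescentMinimalGlue := by
  intro hA hL hC n m hn hm L L' hs hgap hsmall M' _ _ _ _ _ hM' hstd' M _ _ _ _ _ hM
  by_cases hmin : (open scoped ContDiff in ∀ (k : ℕ) (T : Literature.Topology.FourManifolds.FramedLink (Fin k)), 1 ≤ k → k < n →
      (∃ g : Fin k ↪ Fin n, ∀ j : Fin k, L.component (g j) = T.component j ∧ L.framing (g j) = T.framing j) →
      ¬ (∃ (M₀ : Type) (_ : TopologicalSpace M₀) (_ : T2Space M₀) (_ : SecondCountableTopology M₀)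
          (_ : ChartedSpace (EuclideanSpace ℝ (Fin 4)) M₀) (_ : IsManifold (𝓡 4) ∞ M₀), Literature.Topology.FourManifolds.IsRLinkSphere M₀ T))
  · rcases hL n m hn hm L hmin L' hs hgap hsmall M' hM' hstd' M hM with h | ⟨C, hCmin, N, _, _, _, _, _, hN, hsum⟩
    · exact h
    · exact hC n hn L hmin C hCmin hsmall M hM N hN hsum
  · exact hA n hn L hmin hsmall M hM

end Summit.SmoothPoincare4.SmoothPoincare4.Theorems.RootDecompACDiagonalDescentMinimalSplit
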